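import Summits.HubbardSuperconductivity.HubbardSuperconductivity.Theses.LevyLogBootstrap
import Literature.MathematicalPhysics.QuantumLattice.PlaquettePairCouplings
import Literature.MathematicalPhysics.QuantumLattice.LatticeTori
import HarnessLib

/-!
# Crux `DressHalfFilled` (stmt-HubbardSuperconductivity-8148) — ideator 1, round 1: first-lemma sketches

Two crux ideas (cards `idea-feshbach-pair-vacuum.md`, `idea-flip-cohomology-rp-transport.md`).
This file only TYPES their first checkable statements over existing declarations; nothing is
proved here (no `sorry` either: the statements are `def … : Prop`).

Conventions are those of the crux: checkerboard Hubbard torus `H_L(t',U) = hamiltonian G_intra 1 U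
+ hamiltonian G_inter t' 0` on `FermionTorus 2 L`, `4 ∣ L`, quarter doping `N = 3L²/4`, `S^z = 0`;
plaquette torus side `M = L/2`; `plaquettePairCouplings U` = the landed `O(t'²)` dictionary data.
-/

noncomputable section

set_option linter.dupNamespace false

namespace Summit.HubbardSuperconductivity.HubbardSuperconductivity.Cruxes.DressHalfFilled.Ideator1

open scoped BigOperators Matrix ComplexOrder Classical
open Matrix Finset
open Literature.Probability.LatticeModels Literature.MathematicalPhysics.QuantumLattice
open Summit.HubbardSuperconductivity.HubbardSuperconductivity.Theses.LevyLogBootstrap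
  (DressHalfFilled HalfFilledOrder)

/-! ## The checkerboard objects (abbreviations of the crux's own terms) -/

/-- The plaquette label map `x ↦ (⌊x₀/2⌋, ⌊x₁/2⌋)` used by the crux. [bookkeeping] -/
def plaq (L : ℕ) (x : FermionTorus 2 L) : Fin 2 → ℕ := fun i => ((ofLex x) i : ℕ) / 2

/-- Intra-plaquette bond graph `G ∖ comap plaq ⊤` (hopping `1`, on-site `U`). [bookkeeping] -/
abbrev Gintra (L : ℕ) : SimpleGraph (FermionTorus 2 L) :=
  (fermionTorusGraph 2 L) \ SimpleGraph.comap (plaq L) ⊤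

/-- Inter-plaquette bond graph `G ⊓ comap plaq ⊤` (hopping `t'`). [bookkeeping] -/
abbrev Ginter (L : ℕ) : SimpleGraph (FermionTorus 2 L) :=
  (fermionTorusGraph 2 L) ⊓ SimpleGraph.comap (plaq L) ⊤

/-- The checkerboard Hubbard Hamiltonian `H_L(t', U)` of the crux. [bookkeeping] -/
def Hchk (L : ℕ) (U t' : ℝ) :
    Matrix (Finset (Orb (FermionTorus 2 L))) (Finset (Orb (FermionTorus 2 L))) ℂ :=
  hamiltonian (Gintra L) 1 U + hamiltonian (Ginter L) t' 0

/-- The quarter-doping sector `(N, S^z) = (3L²/4, 0)` (= the crux's `2⌊(1-1/4)L²/2⌋` when `4 ∣ L`,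
`quarterDoping_electronCount` in `Lines/birth.lean`). [bookkeeping] -/
def quarterSector (L : ℕ) : Submodule ℂ (Fock (Orb (FermionTorus 2 L))) :=
  szSector (Λ := FermionTorus 2 L) (3 * L ^ 2 / 4) 0

/-- **The pair-vacuum manifold `P`**: the sector ground space of the decoupled plaquettes
`H_in = hamiltonian G_intra 1 U` (under the chord condition: every plaquette in its `2e` or `4e`
ground state, exactly half of each — the hard-core-boson configuration space at boson half filling;
= `range Φ` of `PlaquetteDictionary`). [bookkeeping] -/
def pairVacuum (L : ℕ) (U : ℝ) : Submodule ℂ (Fock (Orb (FermionTorus 2 L))) :=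
  quarterSector L ⊓ Module.End.eigenspace (Matrix.toLin' (hamiltonian (Gintra L) 1 U))
    (((hamiltonian (Gintra L) 1 U).minEnergyOn (quarterSector L) : ℝ) : ℂ)

/-- Orthogonal projector (as a matrix) onto the pair-vacuum manifold. [bookkeeping] -/
def pairVacuumProj (L : ℕ) (U : ℝ) :
    Matrix (Finset (Orb (FermionTorus 2 L))) (Finset (Orb (FermionTorus 2 L))) ℂ :=
  projMatrix ((pairVacuum L U).map
    ((WithLp.linearEquiv 2 ℂ (Finset (Orb (FermionTorus 2 L)) → ℂ)).symm :
      (Finset (Orb (FermionTorus 2 L)) → ℂ) →ₗ[ℂ] _))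

/-- The plaquette CHORD/UNIQUENESS data at `U` — clauses (W3)–(W5) of `PlaquetteData` in
`Lines/birth.lean` (finite-dimensional, certifiable; shared with the birth line's stub 1).
[folklore] -/
def PlaquetteChord (U : ℝ) : Prop :=
  (0 < (plaquettePairCouplings U).pairBinding ∧ 0 < (plaquettePairCouplings U).pairExclusion ∧
    ∀ n : ℕ, n ≤ 8 → n ≠ 2 → n ≠ 4 →
      (4 - (n : ℝ)) * groundEnergyAt plaquetteGraph 1 U 2 + ((n : ℝ) - 2) * groundEnergyAt plaquetteGraph 1 U 4 <
        2 * groundEnergyAt plaquetteGraph 1 U n) ∧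
  (∀ φ₁ φ₂ : Fock (Orb PlaquetteSite), IsGroundStateInSector (plaquetteHamiltonian U) 4 0 φ₁ →
    IsGroundStateInSector (plaquetteHamiltonian U) 4 0 φ₂ → ∃ a : ℂ, φ₂ = a • φ₁) ∧
  (∀ φ₁ φ₂ : Fock (Orb PlaquetteSite), IsGroundStateInSector (plaquetteHamiltonian U) 2 0 φ₁ →
    IsGroundStateInSector (plaquetteHamiltonian U) 2 0 φ₂ → ∃ a : ℂ, φ₂ = a • φ₁) ∧
  (∀ m : ℝ, m = 1 ∨ m = -1 ∨ m = 2 ∨ m = -2 →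
    (plaquetteHamiltonian U).minEnergyOn (szSector 4 0) < (plaquetteHamiltonian U).minEnergyOn (szSector 4 m)) ∧
  (∀ m : ℝ, m = 1 ∨ m = -1 →
    (plaquetteHamiltonian U).minEnergyOn (szSector 2 0) < (plaquetteHamiltonian U).minEnergyOn (szSector 2 m))

/-! ## Card 1 `feshbach-pair-vacuum` — first lemma: the PAIR-BREAKING (quasiparticle) GAP -/

/-- **`QuasiparticleGap`** (first lemma of `feshbach-pair-vacuum`): at small inter-plaquette hopping,
every normalised quarter-doping sector state ORTHOGONAL to the pair-vacuum manifold `P` lies at least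
`Δ_pb/4` above the sector ground energy of the full checkerboard Hamiltonian — uniformly in `L`.
Equivalently `inf spec (Q H_L(t',U) Q |_Q) ≥ E₀(L,t',U) + Δ_pb(U)/4`, the hypothesis that makes the
Feshbach–Schur map at the ground energy EXACT and `L`-uniform. A gapped-type statement (massive
ℤ₂-parity-charged excitation on top of the superfluid), NOT a statement about the superfluid.
Why it might fail: only through the constant (`Δ_pb/4` vs `Δ_pb/2 − O(t')`); a crude AM–GM relative
bound does not prove it (extensive mismatch), a parity-contour / local-surgery argument is needed.
[folklore] -/
def QuasiparticleGap : Prop :=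
  ∀ U : ℝ, 0 < U → PlaquetteChord U →
    ∃ t₁ : ℝ, 0 < t₁ ∧ ∀ t' ∈ Set.Ioo (0:ℝ) t₁, ∀ (L : ℕ) [NeZero L], 8 ≤ L → 4 ∣ L →
      ∀ ψ ∈ quarterSector L, star ψ ⬝ᵥ ψ = 1 →
        (∀ φ ∈ pairVacuum L U, star φ ⬝ᵥ ψ = 0) →
          (Hchk L U t').minEnergyOn (quarterSector L) + (plaquettePairCouplings U).pairBinding / 4
            ≤ (star ψ ⬝ᵥ (Hchk L U t') *ᵥ ψ).re

/-- **`EvenInHopping`** (shared brick of both cards, provable now): the plaquette-parity gauge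
`V = (−1)^{# electrons on odd plaquettes}` (plaquette 2-colouring exists iff `4 ∣ L`) is a
diagonal unitary with `V H_L(t',U) V† = H_L(−t',U)` acting as the identity on the pair-vacuum
manifold (every plaquette charge even there, by the chord condition). Consequence: the Feshbach
operator `F(E;t') = P H P + t'² P T (E − Q H Q)⁻¹ T P` is EXACTLY even in `t'` — the dressed
pair-boson Hamiltonian has no odd orders (the route text's "O(t'³) remainder" is O(t'⁴) in the pair
sector). [folklore] -/
def EvenInHopping : Prop :=
  ∀ (L : ℕ) [NeZero L] (U t' : ℝ), 4 ∣ L → PlaquetteChord U →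
    ∃ V : Matrix (Finset (Orb (FermionTorus 2 L))) (Finset (Orb (FermionTorus 2 L))) ℂ,
      V * Vᴴ = 1 ∧ Vᴴ * V = 1 ∧ V * Hchk L U t' * Vᴴ = Hchk L U (-t') ∧
      ∀ φ ∈ pairVacuum L U, V *ᵥ φ = φ

/-- **The Feshbach operator at energy `E`** (matrix form on the full space; on `P = pairVacuum` it is
`P H P + P H Q (Q (E − H) Q)⁻¹|_Q Q H P`, the `+ P` inside the inverse being the standard device that
makes `Q(E−H)Q` invertible on the whole space without changing its inverse on `Q`). [folklore] -/
def feshbachOp (L : ℕ) (U t' E : ℝ) :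
    Matrix (Finset (Orb (FermionTorus 2 L))) (Finset (Orb (FermionTorus 2 L))) ℂ :=
  let Pm := pairVacuumProj L U
  let Qm := 1 - Pm
  let H := Hchk L U t'
  Pm * H * Pm + Pm * H * Qm * (Qm * ((E : ℂ) • 1 - H) * Qm + Pm)⁻¹ * Qm * H * Pm

/-- **`FeshbachFloor`** (support-level, finite-dimensional linear algebra, provable now): under the
quasiparticle gap, the sector ground energy `E₀` of `H_L(t',U)` is the lowest Rayleigh quotient of
the Feshbach operator `F(E₀)` on the pair-vacuum manifold, and the `P`-component of every sector
ground state attains it (isospectrality of the Feshbach–Schur map at the bottom of the spectrum).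
[folklore] -/
def FeshbachFloor : Prop :=
  ∀ (L : ℕ) [NeZero L] (U t' : ℝ), 4 ∣ L →
    let K := quarterSector L
    let H := Hchk L U t'
    let E₀ := H.minEnergyOn K
    (∀ ψ ∈ K, star ψ ⬝ᵥ ψ = 1 → (∀ φ ∈ pairVacuum L U, star φ ⬝ᵥ ψ = 0) →
        E₀ < (star ψ ⬝ᵥ H *ᵥ ψ).re) →
      (∀ φ ∈ pairVacuum L U, star φ ⬝ᵥ φ = 1 → E₀ ≤ (star φ ⬝ᵥ (feshbachOp L U t' E₀) *ᵥ φ).re) ∧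
      (∀ ψ : Fock (Orb (FermionTorus 2 L)), IsGroundStateInSector H (3 * L ^ 2 / 4) 0 ψ →
        (feshbachOp L U t' E₀) *ᵥ (pairVacuumProj L U *ᵥ ψ) =
          ((E₀ : ℝ) : ℂ) • (pairVacuumProj L U *ᵥ ψ))

/-! ## Card 2 `flip-cohomology-rp-transport` — first lemma: the pseudospin-flip defect of the
dressed pair-boson Hamiltonian is a LOCAL coboundary (the condition for any reflection-positivity
engine to survive dressing at boson half filling) -/

/-- **`FlipDefectLocalCoboundary`**: for the coupling `U` and a dictionary isometry `Φ` (boson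
`M`-torus → pair vacuum, as in `PlaquetteDictionary`), the boson pull-back `F_b(t') = Φᴴ F(E₀;t') Φ`
of the Feshbach operator fails to commute with the GLOBAL PSEUDOSPIN FLIP `Θ = ⊗_R 2Sˣ_R` only by a
term that is, to leading order `t'⁴`, a commutator of the `O(t'²)` model `2J·XXZ(Δ_eff)` with a
TRANSLATION-COVARIANT FINITE-RANGE anti-Hermitian boson operator `K = Σ_R τ_R k₀` whose local norm and
range do NOT grow with `M` (remainder `O(t'⁶)` per plaquette; `Θ = ⊗_R σˣ_R` is written as the
configuration-flip permutation matrix). This is the exact obstruction test: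
DLS/KLS reflection positivity of a hard-core-boson Hamiltonian needs global flip symmetry
(sublattice-rotation trick), so an RP transport along `t'` exists only if the flip-odd dressing is a
local coboundary. Why it might fail: the `O(t'⁴)` flip-odd content (assisted pair hopping
`(b†b'+h.c.)(n''−½)`, odd 3-body densities; `2e` closed-shell vs `4e` open-shell plaquettes) is
generic and a gapless `ad_{XXZ}` rarely has local preimages. [folklore] -/
def FlipDefectLocalCoboundary (U : ℝ) : Prop :=
  ∃ r : ℕ, ∃ C : ℝ, ∃ t₁ : ℝ, 0 < t₁ ∧ ∀ (L M : ℕ) [NeZero L] [NeZero M], L = 2 * M → 8 ≤ L → 4 ∣ L →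
    ∀ Φ : Matrix (Finset (Orb (FermionTorus 2 L))) (TensorIndex (TorusSite 2 M) 2) ℂ,
      Φᴴ * Φ = 1 →
      (∀ φ : TensorIndex (TorusSite 2 M) 2 → ℂ,
          φ ∈ spinZSector (Λ := TorusSite 2 M) 1 0 → Φ *ᵥ φ ∈ pairVacuum L U) →
      (∀ ψ ∈ pairVacuum L U, ∃ φ : TensorIndex (TorusSite 2 M) 2 → ℂ,
          φ ∈ spinZSector (Λ := TorusSite 2 M) 1 0 ∧ ψ = Φ *ᵥ φ) →
      ∃ k₀ : Op (TorusSite 2 M) 2,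
        IsSupportedOn k₀ (torusBall (0 : TorusSite 2 M) r) ∧ k₀ᴴ = -k₀ ∧
        (∃ hk : (Complex.I • k₀).IsHermitian, ∀ i, |hk.eigenvalues i| ≤ C) ∧
        ∀ t' ∈ Set.Ioo (0:ℝ) t₁,
          let E₀ := (Hchk L U t').minEnergyOn (quarterSector L)
          let Fb : Op (TorusSite 2 M) 2 := Φᴴ * feshbachOp L U t' E₀ * Φ
          let Θ : Op (TorusSite 2 M) 2 :=
            Matrix.of fun σ τ => if (∀ R, (τ R : ℕ) = 1 - (σ R : ℕ)) then (1 : ℂ) else 0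
          let K : Op (TorusSite 2 M) 2 := ∑ v : TorusSite 2 M, reindexOp (Equiv.addRight v) k₀
          let F₂ : Op (TorusSite 2 M) 2 :=
            (((2 * (plaquettePairCouplings U).J : ℝ) : ℂ)) •
              xxzHamiltonian 1 (torusGraph 2 M) (-1) (plaquettePairCouplings U).ΔEff
          ∃ hD : (Θ * Fb * Θ - Fb - ((t' ^ 4 : ℝ) : ℂ) • (K * F₂ - F₂ * K)).IsHermitian,
            ∀ i, |hD.eigenvalues i| ≤ C * t' ^ 6 * (M : ℝ) ^ 2

/-! ## How the first lemmas sit under the crux (documentation only)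

`feshbach-pair-vacuum`:  QuasiparticleGap ∧ FeshbachFloor ∧ [linked-cluster transfer of
`⟨Δ_d†Δ_d⟩` through the Bloch wave operator] ∧ BosonCore ⇒ `AnchorAt U (1/4)` ⇒ (with
`HalfFilledOrder` consumed inside BosonCore at `Δ_eff(U)`) `DressHalfFilled`.
`flip-cohomology-rp-transport`:  FlipDefectLocalCoboundary U (all orders) ∧ RP-cone membership of the
flip-symmetrised `F_b` ∧ the route's log-bootstrap along `t'` anchored at `HalfFilledOrder(Δ_eff(U))`
⇒ BosonCore. -/

end Summit.HubbardSuperconductivity.HubbardSuperconductivity.Cruxes.DressHalfFilled.Ideator1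

end
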